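import Summits.SmoothPoincare4.SmoothPoincare4.Theses.InformationMetricHadamard
import Summits.SmoothPoincare4.SmoothPoincare4.Theorems.InformationMetricHadamardC0AhRecognitionStubNormSubLeEdist
import Mathlib.Geometry.Manifold.ContMDiffMFDeriv
import Mathlib.Analysis.SpecialFunctions.Sqrt

/-!
# Line `core-distance-morse`, crux `InformationMetricHadamard.C0AhRecognition` (stmt-SmoothPoincare4-6015) — stub E1, helper 6: the unit radial field from a point is a smooth vector field

In the polar package (`Ex p : ℝ⁵ ≅ W`, `Ex p 0 = p`, `d_G(p, Ex p u) = |u|_{G_p}`, Gauss lemma,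
reversal) the unit radial field from `p`,
`Y_p(z) = d(Ex p)_u (u / |u|_{G_p})`, `u = (Ex p)⁻¹ z` — the velocity field of the unit speed
geodesics issuing from `p`, i.e. the gradient of `d_G(p, ·)` — is a `C^∞` vector field on
`{z ≠ p}` (push-forward of the smooth field `u ↦ u/|u|_{G_p}` on `ℝ⁵ ∖ {0}` by the diffeomorphism
`Ex p`), it is `G`-unit, it equals `−(Ex z)⁻¹ p / d_G(p, z)` (reversal), and along `Ex p` it
reads `Y_p(Ex p u) = d(Ex p)_u(u/|u|_{G_p})`. These are the local building blocks (near field: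
`p` a nearest point; far field: `p = o`) of the Grove–Shiohama gradient-like field of the apex
stub.

* `helper_gradientLikeField_6` — the statement above.

Everything is proved (kind = proof); no definitions.
-/

noncomputable section

-- the prescribed namespace `Summit.<P>.<Sub>.…` duplicates `SmoothPoincare4` (P = Sub)
set_option linter.dupNamespace false

open scoped Manifold ContDiff Topology ENNReal NNReal
open Set Function Bundle

namespace Summit.SmoothPoincare4.SmoothPoincare4.Cruxes.C0AhRecognition.CoreDistanceMorse

open Literature.Geometry.Lorentzian (PseudoRiemannianMetric)

set_option backward.isDefEq.respectTransparency false in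
set_option maxHeartbeats 1600000 in
/-- **E1 helper 6 (the unit radial field from a point).** In the polar package (`Ex p 0 = p`,
`d_G(p, Ex p u) = |u|_{G_p}`, Gauss lemma `G(d(Ex p)_u u, d(Ex p)_u w) = G_p(u, w)`, reversal
`(Ex (Ex p u))⁻¹ p = −d(Ex p)_u u`), for every `p` the field
`Y z = d(Ex p)_u((√G_p(u,u))⁻¹ u)`, `u = (Ex p)⁻¹ z`, is `C^∞` as a section of `TW` on `{z ≠ p}`,
has `G(Y, Y) = 1` there, equals `−(d_G(p, z))⁻¹ (Ex z)⁻¹ p`, and `Y (Ex p u) = d(Ex p)_u((√G_p(u,u))⁻¹ u)`.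
(Lee 2018, Prop. 5.19 with Cor. 6.12: the radial unit field is the push-forward of `∂_r`.)
[cite: Lee2018, Prop. 5.19 and Cor. 6.12] -/
theorem helper_gradientLikeField_6 :
    ∀ (W : Type) [TopologicalSpace W] [T2Space W] [SecondCountableTopology W]
    [ChartedSpace (EuclideanSpace ℝ (Fin 5)) W] [IsManifold (𝓡 5) ∞ W]
    (G : Literature.Geometry.Lorentzian.PseudoRiemannianMetric (𝓡 5) ∞ (EuclideanSpace ℝ (Fin 5))
      (TangentSpace (𝓡 5) : W → Type _)) (hG : G.IsRiemannian)
    (Ex : W → (EuclideanSpace ℝ (Fin 5) ≃ₘ^∞⟮𝓡 5, 𝓡 5⟯ W)),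
    (∀ p : W, Ex p 0 = p) →
    (∀ (p : W) (u : EuclideanSpace ℝ (Fin 5)),
      G.edist hG p (Ex p u) = ENNReal.ofReal (Real.sqrt (G.val p u u))) →
    (∀ (p : W) (u w : EuclideanSpace ℝ (Fin 5)),
      G.val (Ex p u) (mfderiv (𝓡 5) (𝓡 5) (Ex p) u u) (mfderiv (𝓡 5) (𝓡 5) (Ex p) u w) =
        G.val p u w) →
    (∀ (p : W) (u : EuclideanSpace ℝ (Fin 5)),
      (Ex (Ex p u)).symm p = -(mfderiv (𝓡 5) (𝓡 5) (Ex p) u u)) →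
    ∀ p : W, ∃ Y : Π z : W, TangentSpace (𝓡 5) z,
      ContMDiffOn (𝓡 5) (𝓡 5).tangent ∞ (fun z ↦ (⟨z, Y z⟩ : TangentBundle (𝓡 5) W))
        {z : W | z ≠ p} ∧
      (∀ z : W, z ≠ p → G.val z (Y z) (Y z) = 1) ∧
      (∀ z : W, z ≠ p → Y z = -((G.edist hG p z).toReal⁻¹ • (Ex z).symm p)) ∧
      (∀ u : EuclideanSpace ℝ (Fin 5),
        Y (Ex p u) = mfderiv (𝓡 5) (𝓡 5) (Ex p) u ((Real.sqrt (G.val p u u))⁻¹ • u)) := by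
  intro W _ _ _ _ _ G hG Ex h0 hpol hgauss hrev p
  set Φ := Ex p with hΦ
  -- the radial field on `ℝ⁵ ∖ {0}` and its push-forward
  set c : EuclideanSpace ℝ (Fin 5) → ℝ := fun u ↦ (Real.sqrt (G.val p u u))⁻¹ with hc
  set g : EuclideanSpace ℝ (Fin 5) → EuclideanSpace ℝ (Fin 5) := fun u ↦ c u • u with hg
  set Y : Π z : W, TangentSpace (𝓡 5) z :=
    fun z ↦ mfderiv (𝓡 5) (𝓡 5) Φ (Φ.symm z) (g (Φ.symm z)) with hY
  have hΦz : ∀ z : W, Φ (Φ.symm z) = z := fun z ↦ Φ.apply_symm_apply z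
  have hu0 : ∀ z : W, z ≠ p → Φ.symm z ≠ 0 := by
    intro z hz h
    apply hz
    rw [← hΦz z, h, hΦ]
    exact h0 p
  have hQpos : ∀ u : EuclideanSpace ℝ (Fin 5), u ≠ 0 → 0 < G.val p u u := fun u hu ↦ hG p u hu
  refine ⟨Y, ?_, ?_, ?_, ?_⟩
  · -- ### smoothness on `{z ≠ p}`: `T(Ex p) ∘ (u ↦ (u, g u)) ∘ (Ex p)⁻¹`
    -- `g` is smooth on `{u ≠ 0}`
    set B : EuclideanSpace ℝ (Fin 5) →L[ℝ] EuclideanSpace ℝ (Fin 5) →L[ℝ] ℝ := G.val p with hB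
    have hQ : ContDiff ℝ ∞ (fun u : EuclideanSpace ℝ (Fin 5) ↦ B u u) :=
      (B.isBoundedBilinearMap.contDiff).comp (contDiff_id.prodMk contDiff_id)
    have hgs : ContDiffOn ℝ ∞ g {u : EuclideanSpace ℝ (Fin 5) | u ≠ 0} := by
      intro u hu
      have hQu : B u u ≠ 0 := (hQpos u hu).ne'
      have hsq : ContDiffAt ℝ ∞ (fun u : EuclideanSpace ℝ (Fin 5) ↦ Real.sqrt (B u u)) u :=
        (hQ.contDiffAt).sqrt hQu
      have hsq0 : Real.sqrt (B u u) ≠ 0 := (Real.sqrt_pos.2 (hQpos u hu)).ne'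
      exact ((hsq.inv hsq0).smul contDiffAt_id).contDiffWithinAt
    have hsec : ContMDiffOn 𝓘(ℝ, EuclideanSpace ℝ (Fin 5))
        (𝓘(ℝ, EuclideanSpace ℝ (Fin 5)).prod 𝓘(ℝ, EuclideanSpace ℝ (Fin 5))) ∞
        (fun u : EuclideanSpace ℝ (Fin 5) ↦ (TotalSpace.mk' (EuclideanSpace ℝ (Fin 5)) u (g u) :
          TangentBundle 𝓘(ℝ, EuclideanSpace ℝ (Fin 5)) (EuclideanSpace ℝ (Fin 5))))
        {u : EuclideanSpace ℝ (Fin 5) | u ≠ 0} :=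
      contMDiffOn_vectorSpace_iff_contDiffOn.2 hgs
    have hktop : (∞ : ℕ∞ω) + 1 ≤ (∞ : ℕ∞ω) := le_of_eq rfl
    have hT : ContMDiff (𝓡 5).tangent (𝓡 5).tangent ∞ (tangentMap (𝓡 5) (𝓡 5) Φ) :=
      Φ.contMDiff.contMDiff_tangentMap hktop
    have hsymm : ContMDiffOn (𝓡 5) (𝓡 5) ∞ Φ.symm {z : W | z ≠ p} := Φ.symm.contMDiff.contMDiffOn
    have hmaps : MapsTo Φ.symm {z : W | z ≠ p} {u : EuclideanSpace ℝ (Fin 5) | u ≠ 0} :=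
      fun z hz ↦ hu0 z hz
    have hcomp : ContMDiffOn (𝓡 5) (𝓡 5).tangent ∞
        (fun z ↦ tangentMap (𝓡 5) (𝓡 5) Φ
          (TotalSpace.mk' (EuclideanSpace ℝ (Fin 5)) (Φ.symm z) (g (Φ.symm z)) :
            TangentBundle 𝓘(ℝ, EuclideanSpace ℝ (Fin 5)) (EuclideanSpace ℝ (Fin 5))))
        {z : W | z ≠ p} :=
      hT.comp_contMDiffOn (hsec.comp hsymm hmaps)
    refine hcomp.congr fun z _ ↦ ?_
    -- pointwise: `⟨z, Y z⟩ = T(Ex p) ⟨(Ex p)⁻¹ z, g ((Ex p)⁻¹ z)⟩`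
    rw [TotalSpace.ext_iff]
    refine ⟨?_, ?_⟩
    · show z = Φ (Φ.symm z)
      exact (hΦz z).symm
    · exact HEq.rfl
  · -- ### `G(Y, Y) = 1`
    intro z hz
    set u := Φ.symm z with hu
    have huz : Φ u = z := hΦz z
    have hu' : u ≠ 0 := hu0 z hz
    have hQ : 0 < G.val p u u := hQpos u hu'
    have hsq : 0 < Real.sqrt (G.val p u u) := Real.sqrt_pos.2 hQ
    have hYu : Y (Φ u) = mfderiv (𝓡 5) (𝓡 5) Φ u (c u • u) := by
      show mfderiv (𝓡 5) (𝓡 5) Φ (Φ.symm (Φ u)) (g (Φ.symm (Φ u))) = _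
      rw [Φ.symm_apply_apply]
    have hlin : mfderiv (𝓡 5) (𝓡 5) Φ u (c u • u) = c u • mfderiv (𝓡 5) (𝓡 5) Φ u u :=
      ContinuousLinearMap.map_smul _ _ _
    have e1 : G.val (Φ u) (c u • mfderiv (𝓡 5) (𝓡 5) Φ u u) =
        c u • G.val (Φ u) (mfderiv (𝓡 5) (𝓡 5) Φ u u) := ContinuousLinearMap.map_smul _ _ _
    have e2 : G.val (Φ u) (mfderiv (𝓡 5) (𝓡 5) Φ u u) (c u • mfderiv (𝓡 5) (𝓡 5) Φ u u) =
        c u • G.val (Φ u) (mfderiv (𝓡 5) (𝓡 5) Φ u u) (mfderiv (𝓡 5) (𝓡 5) Φ u u) :=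
      ContinuousLinearMap.map_smul _ _ _
    have hval : G.val (Φ u) (Y (Φ u)) (Y (Φ u)) = 1 := by
      rw [hYu, hlin, e1, _root_.smul_apply, e2, hgauss p u u, smul_eq_mul, smul_eq_mul]
      show (Real.sqrt (G.val p u u))⁻¹ * ((Real.sqrt (G.val p u u))⁻¹ * G.val p u u) = 1
      rw [← mul_assoc, ← mul_inv, Real.mul_self_sqrt hQ.le, inv_mul_cancel₀ hQ.ne']
    rw [huz] at hval
    exact hval
  · -- ### `Y z = -(d(p, z))⁻¹ (Ex z)⁻¹ p`
    intro z hz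
    set u := Φ.symm z with hu
    have huz : Φ u = z := hΦz z
    have hd : (G.edist hG p z).toReal = Real.sqrt (G.val p u u) := by
      rw [← huz, hΦ, hpol, ENNReal.toReal_ofReal (Real.sqrt_nonneg _)]
    have hr := hrev p u
    rw [← hΦ] at hr
    have hEq : (Ex (Φ u)).symm p = (Ex z).symm p := by rw [huz]
    -- `Y z = c u • d(Ex p)_u u` as vectors of `ℝ⁵`
    have hYz : (Y z : EuclideanSpace ℝ (Fin 5)) = c u • (mfderiv (𝓡 5) (𝓡 5) Φ u u :
        EuclideanSpace ℝ (Fin 5)) := by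
      show mfderiv (𝓡 5) (𝓡 5) Φ u (c u • u) = c u • mfderiv (𝓡 5) (𝓡 5) Φ u u
      exact ContinuousLinearMap.map_smul _ _ _
    have hM : (mfderiv (𝓡 5) (𝓡 5) Φ u u : EuclideanSpace ℝ (Fin 5)) = -((Ex z).symm p) := by
      rw [← hEq, hr, neg_neg]
    rw [hYz, hM, hd]
    show (Real.sqrt (G.val p u u))⁻¹ • (-((Ex z).symm p)) =
      -((Real.sqrt (G.val p u u))⁻¹ • (Ex z).symm p)
    exact smul_neg _ _
  · -- ### along `Ex p`
    intro u
    show mfderiv (𝓡 5) (𝓡 5) Φ (Φ.symm (Φ u)) (g (Φ.symm (Φ u))) = _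
    rw [Φ.symm_apply_apply]

end Summit.SmoothPoincare4.SmoothPoincare4.Cruxes.C0AhRecognition.CoreDistanceMorse

end
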